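/-
Copyright: the b2b-balaban T⁴-continuum CRUX team, row NE7b OWNER lineage `t4-ne7b-p1` (gen 145). Project licence.
-/
import Summits.QuantumFields.BalabanUV.T4Continuum.Spine.NE7b.SupFifthFormObservables
import Summits.QuantumFields.BalabanUV.T4Continuum.Spine.NE7b.SupGrowthClassLinear
import Summits.QuantumFields.BalabanUV.T4Continuum.Spine.NE7b.SupTiltedMomentContDiff

/-!
# THE TILTED MOMENT OF THE FIFTEEN-TERM INTEGRAND `Ψ` IS `C¹` IN THE BACKGROUND (CONTINUITY OF THE TOP DERIVATIVE, SCOPING-d16 (4),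
# second file).  (636) proved `ψ ↦ ∫e^{−U(ω+ψ)}Ψ_mhkl(ω+ψ)dN(0,Γ)` `DifferentiableAt` every background, for `U ∈ C⁵` with bounded
# `U″, U‴, U⁗, U⁽⁵⁾` under the regulator, by (513) on the observable `p := Ψ_mhkl(·)` with class data (`|p|, ‖p′‖ ≤ C(1+‖U′‖)ⁿ`, `HasFDerivAt`,
# CONTINUITY of `p′` — which uses `hU₅c`) assembled compositionally along the parse tree of `Ψ` (the derivative `p′` never written).  The same
# data fed to (644) `contDiff_one_tilted_moment` give MORE: the moment is `ContDiff ℝ 1` — its derivative (a tilted moment whose integrand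
# contains `U⁽⁵⁾`) is CONTINUOUS in the background by dominated convergence.  This is the one constituent of (521)'s centred fourth-derivative
# display whose `C¹`-ness needs `U ∈ C⁵` with `U⁽⁵⁾` continuous; with (644)'s `Z, G, H, Φ` every moment of the display is `C¹`, so the display is
# `C¹` and the output's fifth-order object `P(ψ) = D(∂⁴W)` ((639)) is continuous — the input's `hU₅c` reproduced (next files) (row NE7b, node
# U5c; (636)'s atoms (581)∕(588)∕(635), (644) BY NAME; [folklore]).

Cell `pub-balaban`, sub-cell `t4`, spine estimate NE7b (`T4WeightBudget.RelWeightBound`; the cell's OWN estimate — NOT PRINTED in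
[Bałaban 1983–89], NOT PROVED).  Crux-route work under `Spine/NE7b/` by the row OWNER (`t4-ne7b-p1` gen 145, file (645)) under FREEZE
(0)'s crux-prover clause; NOTHING of Bałaban's is named as a Lean object, valued or asserted; no `T4Continuum/Support` leaf typed; no
`def`, no notation; zero `sorry`.  Imports (BY NAME): the OWNER's (588) `…SupFifthFormObservables`, (635) `…SupGrowthClassLinear`, (644)
`…SupTiltedMomentContDiff`.

WHAT IS PROVED ([folklore]): **`contDiff_one_psi_moment`**; toy.

HONEST (what this is NOT).  One moment of one observable; the `C¹`-ness of the whole display and the continuity of `P` are the next files;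
the constants are not optimised; `U ∈ C⁵` with bounded derivatives and the regulator are hypotheses; scalar skeleton ((A3), NC-NE7b-α
UNRULED); nothing of Bałaban's asserted.  BY-NAME EFFECT ON THE WALL: NONE.  NE7b NOT PRINTED ∕ NOT PROVED; spine PROVED 0∕9; rung (B)+1 —
the programme's measures remain FINITE-torus statements; NOT the mass gap, NOT Clay.  HONEST DEPENDENCY: continuum YM on T⁴ ⇐ BetaPertH ∧
nine spine estimates (0∕9 proved); BetaPertH ⇐ (D1) ∧ (D4) ∧ CAP+tail; G-an2-4 gates asym, D1 and NE2∕3∕4.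
-/

set_option autoImplicit false
set_option maxSynthPendingDepth 4

noncomputable section

namespace Summit.QuantumFields.BalabanUV.T4Continuum.NE7b.SupFourthFormPsiContDiff

open MeasureTheory ProbabilityTheory Finset Real Matrix
open SupTiltedMomentContDiff (contDiff_one_tilted_moment)
open SupTiltedMomentConstituents (hasFDerivAt_entry_one hasFDerivAt_entry_two)
open SupTiltedMomentPhiConstituent (hasFDerivAt_entry_three)
open SupTiltedCumulantCalculusOne (class_mul_abs_le class_mul_fderiv_le class_mul_fderiv_continuous class_grad_abs_le class_grad_fderiv_le)
open SupGrowthClassLinear (class_add_abs_le class_add_fderiv_le class_sub_abs_le class_sub_fderiv_le class_add_fderiv_continuous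
  class_sub_fderiv_continuous)
open SupFifthFormObservables (hasFDerivAt_entry_four class_hess_abs_le class_hess_fderiv_le class_third_abs_le class_third_fderiv_le
  class_fourth_abs_le class_fourth_fderiv_le continuous_entry_one_fderiv continuous_entry_two_fderiv continuous_entry_three_fderiv
  continuous_entry_four_fderiv)

variable {ι : Type} [Fintype ι] [DecidableEq ι]

section Main

variable {Γ : Matrix ι ι ℝ} {γop : ℝ} {U : EuclideanSpace ℝ ι → ℝ} {U' : EuclideanSpace ℝ ι → EuclideanSpace ℝ ι →L[ℝ] ℝ}
  {U'' : EuclideanSpace ℝ ι → EuclideanSpace ℝ ι →L[ℝ] EuclideanSpace ℝ ι →L[ℝ] ℝ}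
  {U₃ : EuclideanSpace ℝ ι → EuclideanSpace ℝ ι →L[ℝ] EuclideanSpace ℝ ι →L[ℝ] EuclideanSpace ℝ ι →L[ℝ] ℝ}
  {U₄ : EuclideanSpace ℝ ι → EuclideanSpace ℝ ι →L[ℝ] EuclideanSpace ℝ ι →L[ℝ] EuclideanSpace ℝ ι →L[ℝ]
    EuclideanSpace ℝ ι →L[ℝ] ℝ}
  {U₅ : EuclideanSpace ℝ ι → EuclideanSpace ℝ ι →L[ℝ] EuclideanSpace ℝ ι →L[ℝ] EuclideanSpace ℝ ι →L[ℝ]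
    EuclideanSpace ℝ ι →L[ℝ] EuclideanSpace ℝ ι →L[ℝ] ℝ}
  {κ₀ κ₁ a τ δ θ κ₂ κ₃ κ₄ κ₅ : ℝ}

set_option maxHeartbeats 4000000 in
/-- **THE TILTED MOMENT OF `Ψ_mhkl` IS `C¹` IN THE BACKGROUND** (`ContDiff ℝ 1`): for `U ∈ C⁵` with `‖U″‖ ≤ κ₂, ‖U‴‖ ≤ κ₃, ‖U⁗‖ ≤ κ₄,
‖U⁽⁵⁾‖ ≤ κ₅`, `U⁽⁵⁾` continuous, under the regulator — (636)'s compositional class data on the observable `Ψ_mhkl(·)`, closed by (644)'s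
`C¹` engine instead of (513). [folklore] -/
theorem contDiff_one_psi_moment (hΓ : Γ.PosSemidef) (hΓop : (γop • (1 : Matrix ι ι ℝ) - Γ).PosSemidef) (Y : Finset ι)
    (hUd : ∀ φ : EuclideanSpace ℝ ι, HasFDerivAt U (U' φ) φ) (hU'd : ∀ φ : EuclideanSpace ℝ ι, HasFDerivAt U' (U'' φ) φ)
    (hU''d : ∀ φ : EuclideanSpace ℝ ι, HasFDerivAt U'' (U₃ φ) φ) (hU₃d : ∀ φ : EuclideanSpace ℝ ι, HasFDerivAt U₃ (U₄ φ) φ)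
    (hU₄d : ∀ φ : EuclideanSpace ℝ ι, HasFDerivAt U₄ (U₅ φ) φ) (hU₅c : Continuous U₅) (hκ₀ : 0 ≤ κ₀) (hκ₁ : 0 ≤ κ₁) (ha : 0 ≤ a)
    (hτ : 0 < τ) (hδ : 0 < δ) (hθ1 : θ < 1) (hκθ : (2 * κ₀ * (1 + τ) + 4 * δ) * γop ≤ θ)
    (hstab : ∀ φ : EuclideanSpace ℝ ι, -(κ₀ * ∑ x ∈ Y, φ x ^ 2) ≤ U φ) (hU'b : ∀ φ : EuclideanSpace ℝ ι, ‖U' φ‖ ≤ κ₁ * (a + ∑ x ∈ Y, φ x ^ 2))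
    (hU''b : ∀ φ : EuclideanSpace ℝ ι, ‖U'' φ‖ ≤ κ₂) (hU₃b : ∀ φ : EuclideanSpace ℝ ι, ‖U₃ φ‖ ≤ κ₃) (hU₄b : ∀ φ : EuclideanSpace ℝ ι, ‖U₄ φ‖ ≤ κ₄)
    (hU₅b : ∀ φ : EuclideanSpace ℝ ι, ‖U₅ φ‖ ≤ κ₅) (m h k l : EuclideanSpace ℝ ι) :
    ContDiff ℝ 1 (fun ψ : EuclideanSpace ℝ ι => ∫ ω : EuclideanSpace ℝ ι, exp (-U (ω + ψ)) * (U₄ (ω + ψ) m h k l - U' (ω + ψ) k * U₃ (ω + ψ) m h l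
        - U'' (ω + ψ) h l * U'' (ω + ψ) m k - U'' (ω + ψ) h k * U'' (ω + ψ) m l - U' (ω + ψ) l * U₃ (ω + ψ) m h k - U' (ω + ψ) h * U₃ (ω + ψ) m k l
        - U'' (ω + ψ) k l * U'' (ω + ψ) m h + U' (ω + ψ) h * U' (ω + ψ) k * U'' (ω + ψ) m l + U' (ω + ψ) h * U' (ω + ψ) l * U'' (ω + ψ) m k + U' (ω
        + ψ) k * U' (ω + ψ) l * U'' (ω + ψ) m h - (U₃ (ω + ψ) h k l - U' (ω + ψ) k * U'' (ω + ψ) h l - U'' (ω + ψ) h k * U' (ω + ψ) l - U' (ω + ψ) h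
        * U'' (ω + ψ) k l + U' (ω + ψ) h * U' (ω + ψ) k * U' (ω + ψ) l) * U' (ω + ψ) m) ∂(multivariateGaussian 0 Γ)) := by
  have hU'c : Continuous U' := continuous_iff_continuousAt.2 fun φ => (hU'd φ).continuousAt
  have hU''c : Continuous U'' := continuous_iff_continuousAt.2 fun φ => (hU''d φ).continuousAt
  have hU₃c : Continuous U₃ := continuous_iff_continuousAt.2 fun φ => (hU₃d φ).continuousAt
  have hU₄c : Continuous U₄ := continuous_iff_continuousAt.2 fun φ => (hU₄d φ).continuousAt
  have hκ₂ : 0 ≤ κ₂ := (norm_nonneg (U'' 0)).trans (hU''b 0)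
  have d_dd := fun φ : EuclideanSpace ℝ ι => hasFDerivAt_entry_four hU₄d m h k l φ
  have b_dd := fun φ : EuclideanSpace ℝ ι => class_fourth_abs_le (U' := U') hU₄b hU₅b m h k l φ
  have f_dd := fun φ : EuclideanSpace ℝ ι => class_fourth_fderiv_le (U' := U') hU₄b hU₅b m h k l φ
  have c_dd := continuous_entry_four_fderiv hU₅c m h k l
  have d_ak := fun φ : EuclideanSpace ℝ ι => hasFDerivAt_entry_one hU'd k φ
  have b_ak := fun φ : EuclideanSpace ℝ ι => class_grad_abs_le (U' := U') hκ₂ φ k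
  have f_ak := fun φ : EuclideanSpace ℝ ι => class_grad_fderiv_le (U' := U') hU''b φ k
  have c_ak := continuous_entry_one_fderiv hU''c k
  have d_cmhl := fun φ : EuclideanSpace ℝ ι => hasFDerivAt_entry_three hU₃d m h l φ
  have b_cmhl := fun φ : EuclideanSpace ℝ ι => class_third_abs_le (U' := U') hU₃b hU₄b m h l φ
  have f_cmhl := fun φ : EuclideanSpace ℝ ι => class_third_fderiv_le (U' := U') hU₃b hU₄b m h l φ
  have c_cmhl := continuous_entry_three_fderiv hU₄c m h l
  have d_n1 := fun φ : EuclideanSpace ℝ ι => (d_ak φ).mul (d_cmhl φ)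
  have b_n1 := fun φ : EuclideanSpace ℝ ι => class_mul_abs_le b_ak b_cmhl φ
  have f_n1 := fun φ : EuclideanSpace ℝ ι => class_mul_fderiv_le b_ak f_ak b_cmhl f_cmhl φ
  have c_n1 := class_mul_fderiv_continuous d_ak c_ak d_cmhl c_cmhl
  have d_n2 := fun φ : EuclideanSpace ℝ ι => (d_dd φ).sub (d_n1 φ)
  have b_n2 := fun φ : EuclideanSpace ℝ ι => class_sub_abs_le b_dd b_n1 φ
  have f_n2 := fun φ : EuclideanSpace ℝ ι => class_sub_fderiv_le b_dd f_dd b_n1 f_n1 φ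
  have c_n2 := class_sub_fderiv_continuous c_dd c_n1
  have d_bhl := fun φ : EuclideanSpace ℝ ι => hasFDerivAt_entry_two hU''d h l φ
  have b_bhl := fun φ : EuclideanSpace ℝ ι => class_hess_abs_le (U' := U') hU''b hU₃b h l φ
  have f_bhl := fun φ : EuclideanSpace ℝ ι => class_hess_fderiv_le (U' := U') hU''b hU₃b h l φ
  have c_bhl := continuous_entry_two_fderiv hU₃c h l
  have d_bmk := fun φ : EuclideanSpace ℝ ι => hasFDerivAt_entry_two hU''d m k φ
  have b_bmk := fun φ : EuclideanSpace ℝ ι => class_hess_abs_le (U' := U') hU''b hU₃b m k φ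
  have f_bmk := fun φ : EuclideanSpace ℝ ι => class_hess_fderiv_le (U' := U') hU''b hU₃b m k φ
  have c_bmk := continuous_entry_two_fderiv hU₃c m k
  have d_n3 := fun φ : EuclideanSpace ℝ ι => (d_bhl φ).mul (d_bmk φ)
  have b_n3 := fun φ : EuclideanSpace ℝ ι => class_mul_abs_le b_bhl b_bmk φ
  have f_n3 := fun φ : EuclideanSpace ℝ ι => class_mul_fderiv_le b_bhl f_bhl b_bmk f_bmk φ
  have c_n3 := class_mul_fderiv_continuous d_bhl c_bhl d_bmk c_bmk
  have d_n4 := fun φ : EuclideanSpace ℝ ι => (d_n2 φ).sub (d_n3 φ)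
  have b_n4 := fun φ : EuclideanSpace ℝ ι => class_sub_abs_le b_n2 b_n3 φ
  have f_n4 := fun φ : EuclideanSpace ℝ ι => class_sub_fderiv_le b_n2 f_n2 b_n3 f_n3 φ
  have c_n4 := class_sub_fderiv_continuous c_n2 c_n3
  have d_bhk := fun φ : EuclideanSpace ℝ ι => hasFDerivAt_entry_two hU''d h k φ
  have b_bhk := fun φ : EuclideanSpace ℝ ι => class_hess_abs_le (U' := U') hU''b hU₃b h k φ
  have f_bhk := fun φ : EuclideanSpace ℝ ι => class_hess_fderiv_le (U' := U') hU''b hU₃b h k φ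
  have c_bhk := continuous_entry_two_fderiv hU₃c h k
  have d_bml := fun φ : EuclideanSpace ℝ ι => hasFDerivAt_entry_two hU''d m l φ
  have b_bml := fun φ : EuclideanSpace ℝ ι => class_hess_abs_le (U' := U') hU''b hU₃b m l φ
  have f_bml := fun φ : EuclideanSpace ℝ ι => class_hess_fderiv_le (U' := U') hU''b hU₃b m l φ
  have c_bml := continuous_entry_two_fderiv hU₃c m l
  have d_n5 := fun φ : EuclideanSpace ℝ ι => (d_bhk φ).mul (d_bml φ)
  have b_n5 := fun φ : EuclideanSpace ℝ ι => class_mul_abs_le b_bhk b_bml φ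
  have f_n5 := fun φ : EuclideanSpace ℝ ι => class_mul_fderiv_le b_bhk f_bhk b_bml f_bml φ
  have c_n5 := class_mul_fderiv_continuous d_bhk c_bhk d_bml c_bml
  have d_n6 := fun φ : EuclideanSpace ℝ ι => (d_n4 φ).sub (d_n5 φ)
  have b_n6 := fun φ : EuclideanSpace ℝ ι => class_sub_abs_le b_n4 b_n5 φ
  have f_n6 := fun φ : EuclideanSpace ℝ ι => class_sub_fderiv_le b_n4 f_n4 b_n5 f_n5 φ
  have c_n6 := class_sub_fderiv_continuous c_n4 c_n5
  have d_al := fun φ : EuclideanSpace ℝ ι => hasFDerivAt_entry_one hU'd l φ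
  have b_al := fun φ : EuclideanSpace ℝ ι => class_grad_abs_le (U' := U') hκ₂ φ l
  have f_al := fun φ : EuclideanSpace ℝ ι => class_grad_fderiv_le (U' := U') hU''b φ l
  have c_al := continuous_entry_one_fderiv hU''c l
  have d_cmhk := fun φ : EuclideanSpace ℝ ι => hasFDerivAt_entry_three hU₃d m h k φ
  have b_cmhk := fun φ : EuclideanSpace ℝ ι => class_third_abs_le (U' := U') hU₃b hU₄b m h k φ
  have f_cmhk := fun φ : EuclideanSpace ℝ ι => class_third_fderiv_le (U' := U') hU₃b hU₄b m h k φ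
  have c_cmhk := continuous_entry_three_fderiv hU₄c m h k
  have d_n7 := fun φ : EuclideanSpace ℝ ι => (d_al φ).mul (d_cmhk φ)
  have b_n7 := fun φ : EuclideanSpace ℝ ι => class_mul_abs_le b_al b_cmhk φ
  have f_n7 := fun φ : EuclideanSpace ℝ ι => class_mul_fderiv_le b_al f_al b_cmhk f_cmhk φ
  have c_n7 := class_mul_fderiv_continuous d_al c_al d_cmhk c_cmhk
  have d_n8 := fun φ : EuclideanSpace ℝ ι => (d_n6 φ).sub (d_n7 φ)
  have b_n8 := fun φ : EuclideanSpace ℝ ι => class_sub_abs_le b_n6 b_n7 φ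
  have f_n8 := fun φ : EuclideanSpace ℝ ι => class_sub_fderiv_le b_n6 f_n6 b_n7 f_n7 φ
  have c_n8 := class_sub_fderiv_continuous c_n6 c_n7
  have d_ah := fun φ : EuclideanSpace ℝ ι => hasFDerivAt_entry_one hU'd h φ
  have b_ah := fun φ : EuclideanSpace ℝ ι => class_grad_abs_le (U' := U') hκ₂ φ h
  have f_ah := fun φ : EuclideanSpace ℝ ι => class_grad_fderiv_le (U' := U') hU''b φ h
  have c_ah := continuous_entry_one_fderiv hU''c h
  have d_cmkl := fun φ : EuclideanSpace ℝ ι => hasFDerivAt_entry_three hU₃d m k l φ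
  have b_cmkl := fun φ : EuclideanSpace ℝ ι => class_third_abs_le (U' := U') hU₃b hU₄b m k l φ
  have f_cmkl := fun φ : EuclideanSpace ℝ ι => class_third_fderiv_le (U' := U') hU₃b hU₄b m k l φ
  have c_cmkl := continuous_entry_three_fderiv hU₄c m k l
  have d_n9 := fun φ : EuclideanSpace ℝ ι => (d_ah φ).mul (d_cmkl φ)
  have b_n9 := fun φ : EuclideanSpace ℝ ι => class_mul_abs_le b_ah b_cmkl φ
  have f_n9 := fun φ : EuclideanSpace ℝ ι => class_mul_fderiv_le b_ah f_ah b_cmkl f_cmkl φ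
  have c_n9 := class_mul_fderiv_continuous d_ah c_ah d_cmkl c_cmkl
  have d_n10 := fun φ : EuclideanSpace ℝ ι => (d_n8 φ).sub (d_n9 φ)
  have b_n10 := fun φ : EuclideanSpace ℝ ι => class_sub_abs_le b_n8 b_n9 φ
  have f_n10 := fun φ : EuclideanSpace ℝ ι => class_sub_fderiv_le b_n8 f_n8 b_n9 f_n9 φ
  have c_n10 := class_sub_fderiv_continuous c_n8 c_n9
  have d_bkl := fun φ : EuclideanSpace ℝ ι => hasFDerivAt_entry_two hU''d k l φ
  have b_bkl := fun φ : EuclideanSpace ℝ ι => class_hess_abs_le (U' := U') hU''b hU₃b k l φ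
  have f_bkl := fun φ : EuclideanSpace ℝ ι => class_hess_fderiv_le (U' := U') hU''b hU₃b k l φ
  have c_bkl := continuous_entry_two_fderiv hU₃c k l
  have d_bmh := fun φ : EuclideanSpace ℝ ι => hasFDerivAt_entry_two hU''d m h φ
  have b_bmh := fun φ : EuclideanSpace ℝ ι => class_hess_abs_le (U' := U') hU''b hU₃b m h φ
  have f_bmh := fun φ : EuclideanSpace ℝ ι => class_hess_fderiv_le (U' := U') hU''b hU₃b m h φ
  have c_bmh := continuous_entry_two_fderiv hU₃c m h
  have d_n11 := fun φ : EuclideanSpace ℝ ι => (d_bkl φ).mul (d_bmh φ)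
  have b_n11 := fun φ : EuclideanSpace ℝ ι => class_mul_abs_le b_bkl b_bmh φ
  have f_n11 := fun φ : EuclideanSpace ℝ ι => class_mul_fderiv_le b_bkl f_bkl b_bmh f_bmh φ
  have c_n11 := class_mul_fderiv_continuous d_bkl c_bkl d_bmh c_bmh
  have d_n12 := fun φ : EuclideanSpace ℝ ι => (d_n10 φ).sub (d_n11 φ)
  have b_n12 := fun φ : EuclideanSpace ℝ ι => class_sub_abs_le b_n10 b_n11 φ
  have f_n12 := fun φ : EuclideanSpace ℝ ι => class_sub_fderiv_le b_n10 f_n10 b_n11 f_n11 φ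
  have c_n12 := class_sub_fderiv_continuous c_n10 c_n11
  have d_n13 := fun φ : EuclideanSpace ℝ ι => (d_ah φ).mul (d_ak φ)
  have b_n13 := fun φ : EuclideanSpace ℝ ι => class_mul_abs_le b_ah b_ak φ
  have f_n13 := fun φ : EuclideanSpace ℝ ι => class_mul_fderiv_le b_ah f_ah b_ak f_ak φ
  have c_n13 := class_mul_fderiv_continuous d_ah c_ah d_ak c_ak
  have d_n14 := fun φ : EuclideanSpace ℝ ι => (d_n13 φ).mul (d_bml φ)
  have b_n14 := fun φ : EuclideanSpace ℝ ι => class_mul_abs_le b_n13 b_bml φ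
  have f_n14 := fun φ : EuclideanSpace ℝ ι => class_mul_fderiv_le b_n13 f_n13 b_bml f_bml φ
  have c_n14 := class_mul_fderiv_continuous d_n13 c_n13 d_bml c_bml
  have d_n15 := fun φ : EuclideanSpace ℝ ι => (d_n12 φ).add (d_n14 φ)
  have b_n15 := fun φ : EuclideanSpace ℝ ι => class_add_abs_le b_n12 b_n14 φ
  have f_n15 := fun φ : EuclideanSpace ℝ ι => class_add_fderiv_le b_n12 f_n12 b_n14 f_n14 φ
  have c_n15 := class_add_fderiv_continuous c_n12 c_n14
  have d_n16 := fun φ : EuclideanSpace ℝ ι => (d_ah φ).mul (d_al φ)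
  have b_n16 := fun φ : EuclideanSpace ℝ ι => class_mul_abs_le b_ah b_al φ
  have f_n16 := fun φ : EuclideanSpace ℝ ι => class_mul_fderiv_le b_ah f_ah b_al f_al φ
  have c_n16 := class_mul_fderiv_continuous d_ah c_ah d_al c_al
  have d_n17 := fun φ : EuclideanSpace ℝ ι => (d_n16 φ).mul (d_bmk φ)
  have b_n17 := fun φ : EuclideanSpace ℝ ι => class_mul_abs_le b_n16 b_bmk φ
  have f_n17 := fun φ : EuclideanSpace ℝ ι => class_mul_fderiv_le b_n16 f_n16 b_bmk f_bmk φ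
  have c_n17 := class_mul_fderiv_continuous d_n16 c_n16 d_bmk c_bmk
  have d_n18 := fun φ : EuclideanSpace ℝ ι => (d_n15 φ).add (d_n17 φ)
  have b_n18 := fun φ : EuclideanSpace ℝ ι => class_add_abs_le b_n15 b_n17 φ
  have f_n18 := fun φ : EuclideanSpace ℝ ι => class_add_fderiv_le b_n15 f_n15 b_n17 f_n17 φ
  have c_n18 := class_add_fderiv_continuous c_n15 c_n17
  have d_n19 := fun φ : EuclideanSpace ℝ ι => (d_ak φ).mul (d_al φ)
  have b_n19 := fun φ : EuclideanSpace ℝ ι => class_mul_abs_le b_ak b_al φ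
  have f_n19 := fun φ : EuclideanSpace ℝ ι => class_mul_fderiv_le b_ak f_ak b_al f_al φ
  have c_n19 := class_mul_fderiv_continuous d_ak c_ak d_al c_al
  have d_n20 := fun φ : EuclideanSpace ℝ ι => (d_n19 φ).mul (d_bmh φ)
  have b_n20 := fun φ : EuclideanSpace ℝ ι => class_mul_abs_le b_n19 b_bmh φ
  have f_n20 := fun φ : EuclideanSpace ℝ ι => class_mul_fderiv_le b_n19 f_n19 b_bmh f_bmh φ
  have c_n20 := class_mul_fderiv_continuous d_n19 c_n19 d_bmh c_bmh
  have d_n21 := fun φ : EuclideanSpace ℝ ι => (d_n18 φ).add (d_n20 φ)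
  have b_n21 := fun φ : EuclideanSpace ℝ ι => class_add_abs_le b_n18 b_n20 φ
  have f_n21 := fun φ : EuclideanSpace ℝ ι => class_add_fderiv_le b_n18 f_n18 b_n20 f_n20 φ
  have c_n21 := class_add_fderiv_continuous c_n18 c_n20
  have d_chkl := fun φ : EuclideanSpace ℝ ι => hasFDerivAt_entry_three hU₃d h k l φ
  have b_chkl := fun φ : EuclideanSpace ℝ ι => class_third_abs_le (U' := U') hU₃b hU₄b h k l φ
  have f_chkl := fun φ : EuclideanSpace ℝ ι => class_third_fderiv_le (U' := U') hU₃b hU₄b h k l φ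
  have c_chkl := continuous_entry_three_fderiv hU₄c h k l
  have d_n22 := fun φ : EuclideanSpace ℝ ι => (d_ak φ).mul (d_bhl φ)
  have b_n22 := fun φ : EuclideanSpace ℝ ι => class_mul_abs_le b_ak b_bhl φ
  have f_n22 := fun φ : EuclideanSpace ℝ ι => class_mul_fderiv_le b_ak f_ak b_bhl f_bhl φ
  have c_n22 := class_mul_fderiv_continuous d_ak c_ak d_bhl c_bhl
  have d_n23 := fun φ : EuclideanSpace ℝ ι => (d_chkl φ).sub (d_n22 φ)
  have b_n23 := fun φ : EuclideanSpace ℝ ι => class_sub_abs_le b_chkl b_n22 φ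
  have f_n23 := fun φ : EuclideanSpace ℝ ι => class_sub_fderiv_le b_chkl f_chkl b_n22 f_n22 φ
  have c_n23 := class_sub_fderiv_continuous c_chkl c_n22
  have d_n24 := fun φ : EuclideanSpace ℝ ι => (d_bhk φ).mul (d_al φ)
  have b_n24 := fun φ : EuclideanSpace ℝ ι => class_mul_abs_le b_bhk b_al φ
  have f_n24 := fun φ : EuclideanSpace ℝ ι => class_mul_fderiv_le b_bhk f_bhk b_al f_al φ
  have c_n24 := class_mul_fderiv_continuous d_bhk c_bhk d_al c_al
  have d_n25 := fun φ : EuclideanSpace ℝ ι => (d_n23 φ).sub (d_n24 φ)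
  have b_n25 := fun φ : EuclideanSpace ℝ ι => class_sub_abs_le b_n23 b_n24 φ
  have f_n25 := fun φ : EuclideanSpace ℝ ι => class_sub_fderiv_le b_n23 f_n23 b_n24 f_n24 φ
  have c_n25 := class_sub_fderiv_continuous c_n23 c_n24
  have d_n26 := fun φ : EuclideanSpace ℝ ι => (d_ah φ).mul (d_bkl φ)
  have b_n26 := fun φ : EuclideanSpace ℝ ι => class_mul_abs_le b_ah b_bkl φ
  have f_n26 := fun φ : EuclideanSpace ℝ ι => class_mul_fderiv_le b_ah f_ah b_bkl f_bkl φ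
  have c_n26 := class_mul_fderiv_continuous d_ah c_ah d_bkl c_bkl
  have d_n27 := fun φ : EuclideanSpace ℝ ι => (d_n25 φ).sub (d_n26 φ)
  have b_n27 := fun φ : EuclideanSpace ℝ ι => class_sub_abs_le b_n25 b_n26 φ
  have f_n27 := fun φ : EuclideanSpace ℝ ι => class_sub_fderiv_le b_n25 f_n25 b_n26 f_n26 φ
  have c_n27 := class_sub_fderiv_continuous c_n25 c_n26
  have d_n28 := fun φ : EuclideanSpace ℝ ι => (d_ah φ).mul (d_ak φ)
  have b_n28 := fun φ : EuclideanSpace ℝ ι => class_mul_abs_le b_ah b_ak φ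
  have f_n28 := fun φ : EuclideanSpace ℝ ι => class_mul_fderiv_le b_ah f_ah b_ak f_ak φ
  have c_n28 := class_mul_fderiv_continuous d_ah c_ah d_ak c_ak
  have d_n29 := fun φ : EuclideanSpace ℝ ι => (d_n28 φ).mul (d_al φ)
  have b_n29 := fun φ : EuclideanSpace ℝ ι => class_mul_abs_le b_n28 b_al φ
  have f_n29 := fun φ : EuclideanSpace ℝ ι => class_mul_fderiv_le b_n28 f_n28 b_al f_al φ
  have c_n29 := class_mul_fderiv_continuous d_n28 c_n28 d_al c_al
  have d_n30 := fun φ : EuclideanSpace ℝ ι => (d_n27 φ).add (d_n29 φ)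
  have b_n30 := fun φ : EuclideanSpace ℝ ι => class_add_abs_le b_n27 b_n29 φ
  have f_n30 := fun φ : EuclideanSpace ℝ ι => class_add_fderiv_le b_n27 f_n27 b_n29 f_n29 φ
  have c_n30 := class_add_fderiv_continuous c_n27 c_n29
  have d_am := fun φ : EuclideanSpace ℝ ι => hasFDerivAt_entry_one hU'd m φ
  have b_am := fun φ : EuclideanSpace ℝ ι => class_grad_abs_le (U' := U') hκ₂ φ m
  have f_am := fun φ : EuclideanSpace ℝ ι => class_grad_fderiv_le (U' := U') hU''b φ m
  have c_am := continuous_entry_one_fderiv hU''c m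
  have d_n31 := fun φ : EuclideanSpace ℝ ι => (d_n30 φ).mul (d_am φ)
  have b_n31 := fun φ : EuclideanSpace ℝ ι => class_mul_abs_le b_n30 b_am φ
  have f_n31 := fun φ : EuclideanSpace ℝ ι => class_mul_fderiv_le b_n30 f_n30 b_am f_am φ
  have c_n31 := class_mul_fderiv_continuous d_n30 c_n30 d_am c_am
  have d_n32 := fun φ : EuclideanSpace ℝ ι => (d_n21 φ).sub (d_n31 φ)
  have b_n32 := fun φ : EuclideanSpace ℝ ι => class_sub_abs_le b_n21 b_n31 φ
  have f_n32 := fun φ : EuclideanSpace ℝ ι => class_sub_fderiv_le b_n21 f_n21 b_n31 f_n31 φ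
  have c_n32 := class_sub_fderiv_continuous c_n21 c_n31
  exact contDiff_one_tilted_moment hΓ hΓop Y hUd hU'c d_n32 c_n32 hκ₀ hκ₁ ha hτ hδ hθ1 hκθ hstab hU'b b_n32 f_n32

end Main

/-! ## Toy -/

/-- Toy (the compositional class data, one variable): the product rule's derivative term is inferred, never written, and `C¹` follows
from a derivative at every point plus continuity. -/
example (f : ℝ → ℝ) (f' : ℝ → ℝ) (hf : ∀ x, HasDerivAt f (f' x) x) (hc : Continuous f') : ContDiff ℝ 1 fun y => f y * f y :=
  (contDiff_one_iff_hasFDerivAt.2 ⟨fun x => (ContinuousLinearMap.smulRight (1 : ℝ →L[ℝ] ℝ) (f' x)), by fun_prop,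
    fun x => (hf x).hasFDerivAt⟩).mul
  (contDiff_one_iff_hasFDerivAt.2 ⟨fun x => (ContinuousLinearMap.smulRight (1 : ℝ →L[ℝ] ℝ) (f' x)), by fun_prop, fun x => (hf x).hasFDerivAt⟩)

end Summit.QuantumFields.BalabanUV.T4Continuum.NE7b.SupFourthFormPsiContDiff

end
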